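import Mathlib
import Summits.Ventures.PercRepro2.Defs
import Summits.Ventures.PercRepro2.Independence
import Summits.Ventures.PercRepro2.Harris
import Summits.Ventures.PercRepro2.Graph
import Summits.Ventures.PercRepro2.Events
import Summits.Ventures.PercRepro2.GateCylinder
import Summits.Ventures.PercRepro2.CCTRootEdge
import Summits.Ventures.PercRepro2.CDNestedStep
import Summits.Ventures.PercRepro2.CDNestedRouteChain
import Summits.Ventures.PercRepro2.CDNestedRoute
import Summits.Ventures.PercRepro2.CDNestedEdgeLemmas
import Summits.Ventures.PercRepro2.CDNestedMixture
import Summits.Ventures.PercRepro2.CDNestedInternal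
import Summits.Ventures.PercRepro2.CDNestedRoutes

/-!
# Row 2′CD on the fans: a hub `a₃` over a path from `a₁` (blind cell PercRepro2, mine-a g35;
MINE-A.md §90.4, proofs/MINEA-CD-NESTED.md §5)

The first one-parameter family of the general nested-routes theorem.  A FAN: the path
`a₁ = x 0 – x 1 – … – x m` (rungs `r j = {x j, x (j+1)}`) and the hub `a₃` joined to every `x i` by the
spoke `c i = {x i, a₃}`; `a₂`, `o` and anything else may hang anywhere.  Its `a₁–a₃` routes are
`R_i = {r 0, …, r (i-1), c i}` (`i = 0, …, m`), with vertex sets `{a₁, x 1, …, x i, a₃}` — NESTED.  So if,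
under `Q = {a₁ ↮ a₂}`, the event `{a₁ ↔ a₃}` is the union of the route cylinders, row 2′CD holds for
every up-set and every weight vector (`cd_of_fan`): `CDNestedRoutes.cd_of_nested_routes` with the routes
written as lists `(r 0, x 0, x 1), …, (r (i-1), x (i-1), x i), (c i, x i, a₃)`.  Tools: the vertex set of a
route (`mem_foldl_insert_verts`) and **a chained route is walk-ordered** (`walk_of_isChain`: the first
`v` in `S`, each later `v` the `y` of the preceding triple).  `m = 0` is the single spoke, `m = 1` is the
edge against the path `a₁ – x 1 – a₃` (K₄, diamond, paw).  No definition; one seat.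
-/

namespace Summit.Ventures.PercRepro2

namespace CDNestedFan

section Lists

variable {V : Type*} {E : Type*} [DecidableEq V]

/-- Membership in the vertex set of a route. -/
lemma mem_foldl_insert_verts (L : List (E × V × V)) :
    ∀ (S : Finset V) (v : V),
      v ∈ L.foldl (fun acc t => insert t.2.2 acc) S ↔ v ∈ S ∨ ∃ t ∈ L, t.2.2 = v := by
  induction L with
  | nil => intro S v; simp
  | cons u L ih =>
    intro S v
    simp only [List.foldl_cons, ih, Finset.mem_insert, List.mem_cons]
    constructor
    · rintro ((rfl | hS) | ⟨t, ht, rfl⟩)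
      · exact Or.inr ⟨u, Or.inl rfl, rfl⟩
      · exact Or.inl hS
      · exact Or.inr ⟨t, Or.inr ht, rfl⟩
    · rintro (hS | ⟨t, (rfl | ht), rfl⟩)
      · exact Or.inl (Or.inr hS)
      · exact Or.inl (Or.inl rfl)
      · exact Or.inr ⟨t, ht, rfl⟩

/-- **A chained route is walk-ordered**: if the first `v` lies in `S` and every later `v` is the `y` of
the preceding triple, then the route is walk-ordered from `S`. -/
lemma walk_of_isChain : ∀ (L : List (E × V × V)) (S : Finset V),
    (∀ t ∈ L.head?, t.2.1 ∈ S) → List.IsChain (fun t u : E × V × V => u.2.1 = t.2.2) L →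
    ∀ i (hi : i < L.length), (L.get ⟨i, hi⟩).2.1 ∈
      S ∪ ((L.take i).map (fun u => u.2.2)).toFinset
  | [], _, _, _ => fun i hi => absurd hi (by simp)
  | t :: L, S, hhead, hchain => by
    intro i hi
    cases i with
    | zero =>
      simp only [List.get_eq_getElem, List.getElem_cons_zero, List.take_zero, List.map_nil,
        List.toFinset_nil, Finset.union_empty]
      exact hhead t (by simp)
    | succ i =>
      rw [List.isChain_cons] at hchain
      have hhead' : ∀ u ∈ L.head?, u.2.1 ∈ insert t.2.2 S :=
        fun u hu => Finset.mem_insert.2 (Or.inl (hchain.1 u hu))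
      have ih := walk_of_isChain L (insert t.2.2 S) hhead' hchain.2 i (by simpa using hi)
      simp only [List.get_eq_getElem, List.getElem_cons_succ, List.take_succ_cons, List.map_cons,
        List.toFinset_cons, Finset.mem_union, Finset.mem_insert] at ih ⊢
      tauto

end Lists

section Fan

variable {V : Type*} {E : Type*} [Fintype E] [DecidableEq E] [Fintype V] [DecidableEq V]
  {R : Type*} [Field R] [LinearOrder R] [IsStrictOrderedRing R]

/-- **Row 2′CD on the fans.** The path `a₁ = x 0 – x 1 – … – x m` with rungs `r j = {x j, x (j+1)}` and
the hub `a₃` with spokes `c i = {x i, a₃}`; if under `Q = {a₁ ↮ a₂}` the event `{a₁ ↔ a₃}` is the union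
over `i ≤ m` of the cylinders `{r 0, …, r (i-1), c i open}`, then the row holds for every up-set and
every weight vector. -/
theorem cd_of_fan (p : E → R) (hp : IsProbVec p) {ends : E → Sym2 V} {a₁ a₂ a₃ o : V} (m : ℕ)
    (x : ℕ → V) (r c : ℕ → E) (hx0 : x 0 = a₁) (hr : ∀ j, ends (r j) = s(x j, x (j + 1)))
    (hc : ∀ i, ends (c i) = s(x i, a₃)) {𝓔 : Set (Set V)} (h𝓔 : IsUpperSet 𝓔)
    (hQe : (connEvent ends a₁ a₂)ᶜ ∩ connEvent ends a₁ a₃ =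
      (connEvent ends a₁ a₂)ᶜ ∩ ⋃ i ∈ Finset.range (m + 1),
        GateCylinder.cylinder (insert (c i) ((Finset.range i).image r))) :
    let Q := (connEvent ends a₁ a₂)ᶜ
    let U := clusterInEvent ends a₁ 𝓔
    let e := connEvent ends a₁ a₃
    let f := connEvent ends a₂ o
    let N := (connEvent ends a₁ a₃)ᶜ ∩ (connEvent ends a₂ a₃)ᶜ
    let oU := connEvent ends a₁ o ∪ connEvent ends a₂ o
    prob p (Q ∩ N) * (prob p Q * prob p (Q ∩ U ∩ e ∩ f) - prob p (Q ∩ U) * prob p (Q ∩ e ∩ f)) ≤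
      prob p (Q ∩ N ∩ oU) * (prob p Q * prob p (Q ∩ U ∩ e) - prob p (Q ∩ U) * prob p (Q ∩ e)) := by
  intro Q U e f N oU
  -- the routes: the rungs up to `x i`, then the spoke at `x i`
  set L : ℕ → List (E × V × V) :=
    fun i => (List.range i).map (fun j => (r j, x j, x (j + 1))) ++ [(c i, x i, a₃)] with hL
  have hmem : ∀ i t, t ∈ L i ↔ (∃ j < i, (r j, x j, x (j + 1)) = t) ∨ t = (c i, x i, a₃) := by
    intro i t
    simp [hL, List.mem_append, List.mem_map, List.mem_range]
  have hB : ∀ i, i < m + 1 →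
      insert (c i) ((Finset.range i).image r) = (L i).foldl (fun acc t => insert t.1 acc) ∅ := by
    intro i _
    ext b
    rw [CDNestedInternal.mem_foldl_insert_edges]
    simp only [Finset.mem_insert, Finset.mem_image, Finset.mem_range, Finset.notMem_empty, false_or,
      hmem]
    constructor
    · rintro (rfl | ⟨j, hj, rfl⟩)
      · exact ⟨(c i, x i, a₃), Or.inr rfl, rfl⟩
      · exact ⟨(r j, x j, x (j + 1)), Or.inl ⟨j, hj, rfl⟩, rfl⟩
    · rintro ⟨t, (⟨j, hj, rfl⟩ | rfl), rfl⟩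
      · exact Or.inr ⟨j, hj, rfl⟩
      · exact Or.inl rfl
  have hends : ∀ i, i < m + 1 → ∀ t ∈ L i, ends t.1 = s(t.2.1, t.2.2) := by
    intro i _ t ht
    rcases (hmem i t).1 ht with ⟨j, _, rfl⟩ | rfl
    · exact hr j
    · exact hc i
  -- each route is chained, and starts at `a₁`
  have hchain : ∀ i, List.IsChain (fun t u : E × V × V => u.2.1 = t.2.2) (L i) := by
    intro i
    rw [List.isChain_iff_getElem]
    intro j hj
    simp only [hL, List.length_append, List.length_map, List.length_range,
      List.length_singleton] at hj
    have hji : j < i := by omega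
    by_cases hj1 : j + 1 < i
    · simp [hL, hji, hj1]
    · have hi : i = j + 1 := by omega
      subst hi
      simp [hL]
  have hhead : ∀ i, ∀ t ∈ (L i).head?, t.2.1 ∈ ({a₁} : Finset V) := by
    intro i t ht
    rcases i with _ | i
    · simp only [hL, List.range_zero, List.map_nil, List.nil_append, List.head?_cons,
        Option.mem_def, Option.some.injEq] at ht
      subst ht
      simp [hx0]
    · simp only [hL, List.range_succ_eq_map, List.map_cons, List.cons_append, List.head?_cons,
        Option.mem_def, Option.some.injEq] at ht
      subst ht
      simp [hx0]
  have hwalk : ∀ i, i < m + 1 → ∀ j (hj : j < (L i).length), ((L i).get ⟨j, hj⟩).2.1 ∈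
      ({a₁} : Finset V) ∪ (((L i).take j).map (fun u => u.2.2)).toFinset :=
    fun i _ => walk_of_isChain (L i) {a₁} (hhead i) (hchain i)
  -- the vertex sets are nested
  have hnest : ∀ l i, l < i → i < m + 1 →
      (L l).foldl (fun acc t => insert t.2.2 acc) ({a₁} : Finset V) ⊆
        (L i).foldl (fun acc t => insert t.2.2 acc) ({a₁} : Finset V) := by
    intro l i hli _ v hv
    rw [mem_foldl_insert_verts] at hv ⊢
    rcases hv with hv | ⟨t, ht, rfl⟩
    · exact Or.inl hv
    · rcases (hmem l t).1 ht with ⟨j, hj, rfl⟩ | rfl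
      · exact Or.inr ⟨(r j, x j, x (j + 1)), (hmem i _).2 (Or.inl ⟨j, by omega, rfl⟩), rfl⟩
      · exact Or.inr ⟨(c i, x i, a₃), (hmem i _).2 (Or.inr rfl), rfl⟩
  exact CDNestedRoutes.cd_of_nested_routes p hp (m + 1) L
    (fun i => insert (c i) ((Finset.range i).image r))
    (fun i => (L i).foldl (fun acc t => insert t.2.2 acc) {a₁}) hB (fun _ _ => rfl) hends hwalk
    hnest h𝓔 hQe

/-- **Row 2′CD on the fans, one-way form**: it suffices that every configuration with `a₁ ↮ a₂` and
`a₁ ↔ a₃` has some route `{r 0, …, r (i-1), c i}` (`i ≤ m`) open. -/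
theorem cd_of_fan' (p : E → R) (hp : IsProbVec p) {ends : E → Sym2 V} {a₁ a₂ a₃ o : V} (m : ℕ)
    (x : ℕ → V) (r c : ℕ → E) (hx0 : x 0 = a₁) (hr : ∀ j, ends (r j) = s(x j, x (j + 1)))
    (hc : ∀ i, ends (c i) = s(x i, a₃)) {𝓔 : Set (Set V)} (h𝓔 : IsUpperSet 𝓔)
    (hroute : ∀ ω : Config E, ¬ Conn ends ω a₁ a₂ → Conn ends ω a₁ a₃ →
      ∃ i, i < m + 1 ∧ ω ∈ GateCylinder.cylinder (insert (c i) ((Finset.range i).image r))) :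
    let Q := (connEvent ends a₁ a₂)ᶜ
    let U := clusterInEvent ends a₁ 𝓔
    let e := connEvent ends a₁ a₃
    let f := connEvent ends a₂ o
    let N := (connEvent ends a₁ a₃)ᶜ ∩ (connEvent ends a₂ a₃)ᶜ
    let oU := connEvent ends a₁ o ∪ connEvent ends a₂ o
    prob p (Q ∩ N) * (prob p Q * prob p (Q ∩ U ∩ e ∩ f) - prob p (Q ∩ U) * prob p (Q ∩ e ∩ f)) ≤
      prob p (Q ∩ N ∩ oU) * (prob p Q * prob p (Q ∩ U ∩ e) - prob p (Q ∩ U) * prob p (Q ∩ e)) := by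
  refine cd_of_fan p hp m x r c hx0 hr hc h𝓔 ?_
  ext ω
  simp only [Set.mem_inter_iff, Set.mem_compl_iff, mem_connEvent, Set.mem_iUnion, Finset.mem_range,
    exists_prop]
  constructor
  · rintro ⟨hQ, he⟩
    exact ⟨hQ, hroute ω hQ he⟩
  · rintro ⟨hQ, i, hi, hω⟩
    refine ⟨hQ, ?_⟩
    -- the spoke `c i` is open and `x i` is joined to `a₁` by the open rungs
    have hspoke : ω (c i) = true := hω (c i) (Finset.mem_insert_self _ _)
    have hpath : ∀ j, j ≤ i → Conn ends ω a₁ (x j) := by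
      intro j
      induction j with
      | zero => intro _; rw [hx0]; exact conn_refl _ _ _
      | succ j ih =>
        intro hj
        have hrung : ω (r j) = true :=
          hω (r j) (Finset.mem_insert_of_mem (Finset.mem_image_of_mem r (Finset.mem_range.2 (by omega))))
        exact conn_trans (ih (by omega)) (conn_of_openAdj ⟨r j, hrung, hr j⟩)
    exact conn_trans (hpath i le_rfl) (conn_of_openAdj ⟨c i, hspoke, hc i⟩)

end Fan

end CDNestedFan

end Summit.Ventures.PercRepro2
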